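import Mathlib
import Literature.Analysis.FluidPDE.GaussianVortexPlanar
import HarnessLib

/-!
# Helper for stub `stub_coreInverse` (line `braid-closed-large-circulation-gluing`, crux stmt-AnomalousDissipation-3009):
# the derivative of the Burgers profile function is bounded by `½`

For `φ(t) = (1 − e^{−t})/t` (`burgersPhi`, the profile behind the angular velocity `Ω(ξ) = (8π)⁻¹φ(|ξ|²/4)` of the
Gaussian vortex), `|φ′(t)| ≤ ½` for every `t ≥ 0` (`abs_deriv_burgersPhi_le_half`). Off the origin
`φ′(t) = (e^{−t}(1+t) − 1)/t²` and `1 − t²/2 ≤ e^{−t}(1+t) ≤ 1` (the upper bound is `1 + t ≤ eᵗ`; the lower one because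
`ψ(t) = e^{−t}(1+t) − 1 + t²/2` has `ψ(0) = 0`, `ψ′(t) = t(1 − e^{−t}) ≥ 0`); at `t = 0` by continuity of `φ′`.
Consequence used in the energy method for `stub_coreInverse`: `‖DΩ(ξ)‖ ≤ |ξ|/(32π)`, so every product of `Ω` with a function of
the Gaussian class stays in the Gaussian class (moments for the integrations by parts).
-/

set_option linter.dupNamespace false

noncomputable section

open scoped Topology
open Filter Set

namespace Summit.AnomalousDissipation.AnomalousDissipation.Theorems.MarginalStabilityChainStretchedVortexRows

open Literature.Analysis.FluidPDE

/-- `e^{−t}(1 + t) ≤ 1` (for every real `t`, from `1 + t ≤ eᵗ`). [folklore] -/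
theorem exp_neg_mul_one_add_le_one (t : ℝ) : Real.exp (-t) * (1 + t) ≤ 1 := by
  have h1 : 1 + t ≤ Real.exp t := by linarith [Real.add_one_le_exp t]
  have h2 : Real.exp (-t) * Real.exp t = 1 := by rw [← Real.exp_add]; simp
  calc Real.exp (-t) * (1 + t) ≤ Real.exp (-t) * Real.exp t :=
        mul_le_mul_of_nonneg_left h1 (Real.exp_pos _).le
    _ = 1 := h2

/-- `1 − t²/2 ≤ e^{−t}(1 + t)` for `0 ≤ t` (the function `e^{−t}(1+t) − 1 + t²/2` vanishes at `0` and is nondecreasing,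
with derivative `t(1 − e^{−t}) ≥ 0`). [folklore] -/
theorem one_sub_sq_div_two_le_exp_neg_mul_one_add {t : ℝ} (ht : 0 ≤ t) :
    1 - t ^ 2 / 2 ≤ Real.exp (-t) * (1 + t) := by
  set ψ : ℝ → ℝ := fun s => Real.exp (-s) * (1 + s) - 1 + s ^ 2 / 2 with hψ
  have hderiv : ∀ s, HasDerivAt ψ (s * (1 - Real.exp (-s))) s := by
    intro s
    have h1 : HasDerivAt (fun s : ℝ => Real.exp (-s)) (-Real.exp (-s)) s := by
      simpa using ((hasDerivAt_id s).neg).exp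
    have h2 : HasDerivAt (fun s : ℝ => 1 + s) 1 s := by
      simpa using (hasDerivAt_id s).const_add 1
    have h3 : HasDerivAt (fun s : ℝ => s ^ 2 / 2) s s := by
      have := (hasDerivAt_pow 2 s).div_const 2
      simpa using this
    have h := ((h1.mul h2).sub_const 1).add h3
    refine h.congr_deriv ?_
    ring
  have hmono : MonotoneOn ψ (Ici 0) := by
    refine monotoneOn_of_deriv_nonneg (convex_Ici 0) ?_ ?_ ?_
    · exact HasDerivAt.continuousOn fun s _ => hderiv s
    · intro s _
      exact (hderiv s).differentiableAt.differentiableWithinAt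
    · intro s hs
      rw [interior_Ici] at hs
      rw [(hderiv s).deriv]
      have hs' : 0 ≤ s := le_of_lt hs
      have : Real.exp (-s) ≤ 1 := Real.exp_le_one_iff.2 (by linarith)
      exact mul_nonneg hs' (by linarith)
  have h0 : ψ 0 = 0 := by simp [hψ]
  have := hmono self_mem_Ici ht ht
  rw [h0] at this
  simp only [hψ] at this
  linarith

/-- Off the origin, `φ′(t) = (e^{−t}(1 + t) − 1)/t²`. [folklore] -/
theorem hasDerivAt_burgersPhi_of_ne_zero {t : ℝ} (ht : t ≠ 0) :
    HasDerivAt burgersPhi ((Real.exp (-t) * (1 + t) - 1) / t ^ 2) t := by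
  have heq : burgersPhi =ᶠ[𝓝 t] fun s => (1 - Real.exp (-s)) / s := by
    filter_upwards [isOpen_ne.mem_nhds ht] with s hs
    exact burgersPhi_of_ne_zero hs
  have h1 : HasDerivAt (fun s : ℝ => 1 - Real.exp (-s)) (Real.exp (-t)) t := by
    have : HasDerivAt (fun s : ℝ => Real.exp (-s)) (-Real.exp (-t)) t := by
      simpa using ((hasDerivAt_id t).neg).exp
    simpa using this.const_sub 1
  have h2 : HasDerivAt (fun s : ℝ => s) 1 t := hasDerivAt_id t
  have h := h1.div h2 ht
  refine (h.congr_of_eventuallyEq heq).congr_deriv ?_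
  field_simp
  ring

/-- **`|φ′(t)| ≤ ½` for `t ≥ 0`.** [folklore] -/
theorem abs_deriv_burgersPhi_le_half : ∀ t : ℝ, 0 ≤ t → |deriv burgersPhi t| ≤ 1 / 2 := by
  -- first for `t > 0`, by the closed form
  have hpos : ∀ t : ℝ, 0 < t → |deriv burgersPhi t| ≤ 1 / 2 := by
    intro t ht
    rw [(hasDerivAt_burgersPhi_of_ne_zero ht.ne').deriv, abs_div, abs_of_pos (pow_pos ht 2),
      div_le_iff₀ (pow_pos ht 2)]
    have hu := exp_neg_mul_one_add_le_one t
    have hl := one_sub_sq_div_two_le_exp_neg_mul_one_add ht.le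
    rw [abs_le]
    constructor <;> nlinarith
  intro t ht
  rcases ht.eq_or_lt with rfl | ht'
  · -- `t = 0`: continuity of `φ′` and the bound on `(0, ∞)`
    have hcont : Continuous (deriv burgersPhi) :=
      (contDiff_burgersPhi (n := 1)).continuous_deriv le_rfl
    have hlim : Tendsto (fun s => |deriv burgersPhi s|) (𝓝[>] 0) (𝓝 |deriv burgersPhi 0|) :=
      ((continuous_abs.comp hcont).tendsto 0).mono_left nhdsWithin_le_nhds
    refine le_of_tendsto hlim ?_
    filter_upwards [self_mem_nhdsWithin] with s hs
    exact hpos s hs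
  · exact hpos t ht'

end Summit.AnomalousDissipation.AnomalousDissipation.Theorems.MarginalStabilityChainStretchedVortexRows

end
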